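import Literature.NumberTheory.PAdicHodge.BmaxPlusBdRModFilRing
import Literature.NumberTheory.PAdicHodge.BmaxPlusBdRModFilLog
import Literature.NumberTheory.PAdicHodge.BmaxPlusBdRModFilTheta
import Literature.NumberTheory.PAdicHodge.BmaxPlusBdRModFilGalois
import HarnessLib

/-!
# The comparison ring homomorphism `B_max⁺(F) → B_dR⁺(F)`

Topic `Literature/NumberTheory/PAdicHodge`; namespace `Literature.NumberTheory.PAdicHodge`. Colmez's INJECTION of the crystalline period ring
`B_max⁺ = A_max = (𝔸_inf[ξ/p])^_(p)` into `B_dR⁺` (Colmez 1998 §III.2; Berger 2002 §1.2: «`B_max⁺ ⊂ B_dR⁺`»), announced as «not yet here» in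
`BmaxPlus.lean`. The files `BmaxPlusBdRModFil{,Ring,Log,Theta,Galois}` constructed it MODULO EVERY `Fil^k`: for `x ∈ B_max⁺` and `k ∈ ℕ` an element
`L ∈ B_dR⁺`, unique modulo `ξ^k B_dR⁺`, such that the images `ι₀(y)` of the `p`-adic approximations `y ∈ B⁰_max` of `x` converge to `L` modulo `Fil^k` for
Fontaine's lattice topology (`exists_bdR_lim_modFil`). Here these limits are glued along `k` (`B_dR⁺` is `ξ`-adically complete and separated,
`isAdicComplete_span_xiBdR`) into an honest element:

* `IsBdRLimModFil x k L r` — NAME for the limit predicate of `BmaxPlusBdRModFil` (definitionally the hypothesis of all the `bdR_lim_modFil_*` lemmas);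
  `IsBdRLimModFil.of_sub_mem` (invariance under `L ↦ L + ξ^k w`); `exists_forall_isBdRLimModFil` (ONE `L` that is a limit modulo EVERY `Fil^k`);
  `eq_of_forall_isBdRLimModFil` (such an `L` is unique).
* ★★ `bmaxPlusToBdR : BmaxPlus F p →+* BDeRhamPlus (integerC F) p` — **the comparison ring homomorphism** (`x ↦` the unique all-`k` limit; a ring map by
  `bdR_lim_modFil_add/_mul` and uniqueness), with `isBdRLimModFil_bmaxPlusToBdR` (it IS a limit modulo every `Fil^k`), `bmaxPlusToBdR_eq_of_forall`,
  `sub_bmaxPlusToBdR_mem` (any limit modulo `Fil^k` agrees with it modulo `ξ^k`);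
* values: `bmaxPlusToBdR_of` (`= ι₀` on `B⁰_max`), `bmaxPlusToBdR_ainfToBmaxPlus` (`= ι` on `𝔸_inf`), ★ `bmaxPlusToBdR_tBmax` (**`t ↦ t`**),
  ★ `thetaBdR_bmaxPlusToBdR` (**`θ_dR ∘ (B_max⁺ → B_dR⁺) = θ_max`**), ★ `galBdRPlus_bmaxPlusToBdR` (**`Γ_F`-equivariance**).

Purpose (line `kato_lever`, crux K★ `stmt-BirchSwinnertonDyer-22226`, B8b of the φ-road, memo
`Summits/…/Cruxes/StarredOptimalManinUnitFiveSeven/Lines/kato-lever-K2-tower-instantiation.md` §3): the socket's capstone needs HONEST additive,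
`Γ_F`-equivariant period maps `T_pŴ → B_dR⁺`; composing the `A_max`-periods `v ↦ L_v, φL_v` with this ring map provides them. Injectivity and the
filtration on `B_max⁺` are NOT treated here. Definitions (reviewed): `IsBdRLimModFil`, `bmaxPlusToBdR`. No named facts, no instances, no `sorry`.
Infrastructure only; BSD / K★ are not proved by any of this.

## References
* [Colmez1998Annals] P. Colmez, *Théorie d'Iwasawa des représentations de de Rham d'un corps local*, Ann. of Math. 148 (1998), §III.2.
* [BergerLaurent2002] L. Berger, *Représentations p-adiques et équations différentielles*, Invent. Math. 148 (2002), §1.2.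
* [FontaineAsterisque223III] J.-M. Fontaine, *Le corps des périodes p-adiques*, Astérisque 223 (1994), Exp. II §1.5.3–1.5.5.
-/

noncomputable section

open WittVector Field ValuativeRel
open Literature.AlgebraicGeometry.Resolution

namespace Literature.NumberTheory.PAdicHodge

open Literature.NumberTheory.GaloisRepresentations
open Literature.NumberTheory.GaloisRepresentations.IsNonarchimedeanLocalField

variable {F : Type} [Field F] [ValuativeRel F] [TopologicalSpace F] [IsNonarchimedeanLocalField F]
  [CharZero F] {p : ℕ} [Fact p.Prime] [Fact (¬ IsUnit (p : integerC F))]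
  [IsAdicComplete (Ideal.span {(p : integerC F)}) (integerC F)]

/-! ## §1 The limit predicate and its gluing along `k` -/

variable (F p) in
omit [CharZero F] in
/-- **`L ∈ B_dR⁺` is a limit of `x ∈ B_max⁺` modulo `Fil^k` with shift `r`**: for all `N`, all `M ≥ N + r` and every representative `y ∈ B⁰_max` of
`x mod p^M`, `p^k·(L − ι₀(y)) ∈ Λ(N, k) = p^N·ι(𝔸_inf) + ξ^k·B_dR⁺` — the predicate produced by `BmaxPlusBdRModFil.exists_bdR_lim_modFil` and consumed by
all `bdR_lim_modFil_*` lemmas (definitionally). [cite: Colmez1998Annals, §III.2] [cite: FontaineAsterisque223III, Exp. II §1.5.3] -/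
def IsBdRLimModFil (x : BmaxPlus F p) (k : ℕ) (L : BDeRhamPlus (integerC F) p) (r : ℕ) : Prop :=
  ∀ N M : ℕ, N + r ≤ M → ∀ y : bmaxZero F p,
    AdicCompletion.evalₐ (Ideal.span {(p : bmaxZero F p)}) M x = Ideal.Quotient.mk _ y →
    ∃ (a : Ainf (p := p) F) (w : BDeRhamPlus (integerC F) p),
      (p : BDeRhamPlus (integerC F) p) ^ k *
          (L - algebraMap (Localization.Away (p : Ainf (p := p) F)) (BDeRhamPlus (integerC F) p)
            (y : Localization.Away (p : Ainf (p := p) F))) =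
        ainfToBdR ((p : Ainf (p := p) F) ^ N * a) + xiBdR ^ k * w

/-- For every `x` and `k` there is a limit modulo `Fil^k` (`exists_bdR_lim_modFil`). [cite: Colmez1998Annals, §III.2] -/
theorem exists_isBdRLimModFil (x : BmaxPlus F p) (k : ℕ) : ∃ (L : BDeRhamPlus (integerC F) p) (r : ℕ), IsBdRLimModFil F p x k L r :=
  exists_bdR_lim_modFil x k

omit [CharZero F] in
/-- **Invariance under `Fil^k`**: if `L` is a limit of `x` modulo `Fil^k` and `L′ − L ∈ ξ^k B_dR⁺` then so is `L′` (same shift).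
[cite: FontaineAsterisque223III, Exp. II §1.5.3] -/
theorem IsBdRLimModFil.of_sub_mem {x : BmaxPlus F p} {k : ℕ} {L L' : BDeRhamPlus (integerC F) p} {r : ℕ} (h : IsBdRLimModFil F p x k L r)
    (hL' : L' - L ∈ Ideal.span {(xiBdR : BDeRhamPlus (integerC F) p) ^ k}) : IsBdRLimModFil F p x k L' r := by
  intro N M hM y hy
  obtain ⟨a, w, e⟩ := h N M hM y hy
  obtain ⟨w', hw'⟩ := Ideal.mem_span_singleton'.1 hL'
  refine ⟨a, w + (p : BDeRhamPlus (integerC F) p) ^ k * w', ?_⟩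
  linear_combination e - ((p : BDeRhamPlus (integerC F) p) ^ k) * hw'

/-- Two limits of the same `x` modulo `Fil^k` agree modulo `ξ^k` (`sub_mem_span_xiBdR_pow_of_bdR_lim_modFil`). [cite: Colmez1998Annals, §III.2] -/
theorem IsBdRLimModFil.sub_mem {x : BmaxPlus F p} {k : ℕ} {L₁ L₂ : BDeRhamPlus (integerC F) p} {r₁ r₂ : ℕ}
    (h₁ : IsBdRLimModFil F p x k L₁ r₁) (h₂ : IsBdRLimModFil F p x k L₂ r₂) :
    L₁ - L₂ ∈ Ideal.span {(xiBdR : BDeRhamPlus (integerC F) p) ^ k} :=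
  sub_mem_span_xiBdR_pow_of_bdR_lim_modFil h₁ h₂

omit [CharZero F] in
/-- A limit modulo `Fil^{k′}` is a limit modulo `Fil^k` for `k ≤ k′` (`bdR_lim_modFil_of_le`). [cite: Colmez1998Annals, §III.2] -/
theorem IsBdRLimModFil.of_le {x : BmaxPlus F p} {k k' : ℕ} (hkk' : k ≤ k') {L : BDeRhamPlus (integerC F) p} {r : ℕ}
    (h : IsBdRLimModFil F p x k' L r) : IsBdRLimModFil F p x k L (r + (k' - k)) :=
  bdR_lim_modFil_of_le hkk' h

/-- ★ **Gluing along `k`: ONE element of `B_dR⁺` that is a limit of `x` modulo EVERY `Fil^k`.** The chosen limits `L_k` form a `ξ`-adic Cauchy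
sequence (`L_{k′} ≡ L_k mod ξ^k`), and `B_dR⁺` is `ξ`-adically complete (`isAdicComplete_span_xiBdR`); the limit is again a limit modulo each `Fil^k`
(`IsBdRLimModFil.of_sub_mem`). [cite: Colmez1998Annals, §III.2] [cite: FontaineAsterisque223III, Exp. II §1.5.5] -/
theorem exists_forall_isBdRLimModFil (x : BmaxPlus F p) :
    ∃ L : BDeRhamPlus (integerC F) p, ∀ k : ℕ, ∃ r : ℕ, IsBdRLimModFil F p x k L r := by
  choose Lk rk hLk using fun k => exists_isBdRLimModFil x k
  haveI := isAdicComplete_span_xiBdR (F := F) (p := p)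
  have hcauchy : ∀ {m n : ℕ}, m ≤ n →
      Lk m ≡ Lk n [SMOD ((Ideal.span {(xiBdR : BDeRhamPlus (integerC F) p)}) ^ m • ⊤ :
        Submodule (BDeRhamPlus (integerC F) p) (BDeRhamPlus (integerC F) p))] := by
    intro m n hmn
    rw [SModEq.sub_mem, smul_eq_mul, Ideal.mul_top, Ideal.span_singleton_pow]
    exact (hLk m).sub_mem ((hLk n).of_le hmn)
  obtain ⟨L, hL⟩ := IsPrecomplete.prec (IsAdicComplete.toIsPrecomplete (I := Ideal.span {(xiBdR : BDeRhamPlus (integerC F) p)})) hcauchy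
  refine ⟨L, fun k => ⟨rk k, (hLk k).of_sub_mem ?_⟩⟩
  have h := (hL k).symm
  rw [SModEq.sub_mem, smul_eq_mul, Ideal.mul_top, Ideal.span_singleton_pow] at h
  exact h

/-- ★ **Uniqueness of the all-`k` limit**: two elements of `B_dR⁺` that are limits of `x` modulo every `Fil^k` are equal (`B_dR⁺` is `ξ`-adically
separated). [cite: FontaineAsterisque223III, Exp. II §1.5.5] -/
theorem eq_of_forall_isBdRLimModFil {x : BmaxPlus F p} {L₁ L₂ : BDeRhamPlus (integerC F) p}
    (h₁ : ∀ k : ℕ, ∃ r : ℕ, IsBdRLimModFil F p x k L₁ r) (h₂ : ∀ k : ℕ, ∃ r : ℕ, IsBdRLimModFil F p x k L₂ r) : L₁ = L₂ := by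
  haveI := isAdicComplete_span_xiBdR (F := F) (p := p)
  refine sub_eq_zero.1 (IsHausdorff.haus (IsAdicComplete.toIsHausdorff (I := Ideal.span {(xiBdR : BDeRhamPlus (integerC F) p)})) (L₁ - L₂)
    fun k => ?_)
  obtain ⟨r₁, h₁'⟩ := h₁ k
  obtain ⟨r₂, h₂'⟩ := h₂ k
  rw [smul_eq_mul, Ideal.mul_top, Ideal.span_singleton_pow, SModEq.zero]
  exact h₁'.sub_mem h₂'

/-! ## §2 The comparison ring homomorphism -/

variable (F p) in
/-- **The comparison map `B_max⁺ → B_dR⁺` as a bare function**: `x ↦` the (chosen, then provably unique) element of `B_dR⁺` that is a limit of `x`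
modulo every `Fil^k` (`exists_forall_isBdRLimModFil`); bundled as a ring homomorphism in `bmaxPlusToBdR`. [cite: Colmez1998Annals, §III.2] -/
def bmaxPlusToBdRFun (x : BmaxPlus F p) : BDeRhamPlus (integerC F) p := Classical.choose (exists_forall_isBdRLimModFil x)

/-- `bmaxPlusToBdRFun x` is a limit of `x` modulo every `Fil^k`. [cite: Colmez1998Annals, §III.2] -/
theorem isBdRLimModFil_bmaxPlusToBdRFun (x : BmaxPlus F p) (k : ℕ) : ∃ r : ℕ, IsBdRLimModFil F p x k (bmaxPlusToBdRFun F p x) r :=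
  Classical.choose_spec (exists_forall_isBdRLimModFil x) k

/-- Characterisation of `bmaxPlusToBdRFun x` by the all-`k` limit property. [cite: Colmez1998Annals, §III.2] -/
theorem bmaxPlusToBdRFun_eq_of_forall {x : BmaxPlus F p} {L : BDeRhamPlus (integerC F) p}
    (h : ∀ k : ℕ, ∃ r : ℕ, IsBdRLimModFil F p x k L r) : bmaxPlusToBdRFun F p x = L :=
  eq_of_forall_isBdRLimModFil (isBdRLimModFil_bmaxPlusToBdRFun x) h

/-- On `𝔸_inf` the function is `ι` (`bdR_lim_modFil_ainfToBmaxPlus`). [cite: Colmez1998Annals, §III.2] -/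
theorem bmaxPlusToBdRFun_ainfToBmaxPlus (a : Ainf (p := p) F) : bmaxPlusToBdRFun F p (ainfToBmaxPlus F p a) = ainfToBdR a :=
  bmaxPlusToBdRFun_eq_of_forall fun k => ⟨0, bdR_lim_modFil_ainfToBmaxPlus a k⟩

/-- `bmaxPlusToBdRFun 1 = 1` (`1 = ι(1)`). [cite: Colmez1998Annals, §III.2] -/
theorem bmaxPlusToBdRFun_one : bmaxPlusToBdRFun F p 1 = 1 := by
  have h := bmaxPlusToBdRFun_ainfToBmaxPlus (F := F) (p := p) 1
  rwa [map_one, map_one] at h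

/-- `bmaxPlusToBdRFun 0 = 0` (`0 = ι(0)`). [cite: Colmez1998Annals, §III.2] -/
theorem bmaxPlusToBdRFun_zero : bmaxPlusToBdRFun F p 0 = 0 := by
  have h := bmaxPlusToBdRFun_ainfToBmaxPlus (F := F) (p := p) 0
  rwa [map_zero, map_zero] at h

/-- **Multiplicativity** (`bdR_lim_modFil_mul` + uniqueness). [cite: Colmez1998Annals, §III.2] -/
theorem bmaxPlusToBdRFun_mul (x y : BmaxPlus F p) :
    bmaxPlusToBdRFun F p (x * y) = bmaxPlusToBdRFun F p x * bmaxPlusToBdRFun F p y := by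
  refine bmaxPlusToBdRFun_eq_of_forall fun k => ?_
  obtain ⟨r₁, h₁⟩ := isBdRLimModFil_bmaxPlusToBdRFun x k
  obtain ⟨r₂, h₂⟩ := isBdRLimModFil_bmaxPlusToBdRFun y k
  exact bdR_lim_modFil_mul h₁ h₂

/-- **Additivity** (`bdR_lim_modFil_add` + uniqueness). [cite: Colmez1998Annals, §III.2] -/
theorem bmaxPlusToBdRFun_add (x y : BmaxPlus F p) :
    bmaxPlusToBdRFun F p (x + y) = bmaxPlusToBdRFun F p x + bmaxPlusToBdRFun F p y := by
  refine bmaxPlusToBdRFun_eq_of_forall fun k => ?_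
  obtain ⟨r₁, h₁⟩ := isBdRLimModFil_bmaxPlusToBdRFun x k
  obtain ⟨r₂, h₂⟩ := isBdRLimModFil_bmaxPlusToBdRFun y k
  exact ⟨r₁ + r₂, bdR_lim_modFil_add h₁ h₂⟩

variable (F p) in
/-- ★★ **The comparison ring homomorphism `B_max⁺(F) → B_dR⁺(F)`** (Colmez's injection `B_max⁺ ⊂ B_dR⁺`): `x ↦` the unique element of `B_dR⁺` that is a
limit of `x` modulo every `Fil^k` (`exists_forall_isBdRLimModFil`); additive and multiplicative because sums and products of limits are limits
(`bdR_lim_modFil_add`, `bdR_lim_modFil_mul`) and all-`k` limits are unique. [cite: Colmez1998Annals, §III.2] [cite: BergerLaurent2002, §1.2] -/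
def bmaxPlusToBdR : BmaxPlus F p →+* BDeRhamPlus (integerC F) p where
  toFun := bmaxPlusToBdRFun F p
  map_one' := bmaxPlusToBdRFun_one
  map_mul' := bmaxPlusToBdRFun_mul
  map_zero' := bmaxPlusToBdRFun_zero
  map_add' := bmaxPlusToBdRFun_add

/-- Unfolding: `bmaxPlusToBdR x = bmaxPlusToBdRFun x`. [cite: Colmez1998Annals, §III.2] -/
theorem bmaxPlusToBdR_apply (x : BmaxPlus F p) : bmaxPlusToBdR F p x = bmaxPlusToBdRFun F p x := rfl

/-- **`bmaxPlusToBdR x` is a limit of `x` modulo every `Fil^k`.** [cite: Colmez1998Annals, §III.2] -/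
theorem isBdRLimModFil_bmaxPlusToBdR (x : BmaxPlus F p) (k : ℕ) : ∃ r : ℕ, IsBdRLimModFil F p x k (bmaxPlusToBdR F p x) r :=
  isBdRLimModFil_bmaxPlusToBdRFun x k

/-- **Characterisation**: any element that is a limit of `x` modulo every `Fil^k` IS `bmaxPlusToBdR x`. [cite: Colmez1998Annals, §III.2] -/
theorem bmaxPlusToBdR_eq_of_forall {x : BmaxPlus F p} {L : BDeRhamPlus (integerC F) p} (h : ∀ k : ℕ, ∃ r : ℕ, IsBdRLimModFil F p x k L r) :
    bmaxPlusToBdR F p x = L :=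
  eq_of_forall_isBdRLimModFil (isBdRLimModFil_bmaxPlusToBdR x) h

/-- ★ **Compatibility with the limits modulo `Fil^k`**: every limit `L` of `x` modulo `Fil^k` satisfies `L − bmaxPlusToBdR x ∈ ξ^k B_dR⁺` — so every
`bdR_lim_modFil_*` statement of `BmaxPlusBdRModFil*` is a statement about `bmaxPlusToBdR x mod Fil^k`. [cite: Colmez1998Annals, §III.2] -/
theorem sub_bmaxPlusToBdR_mem {x : BmaxPlus F p} {k : ℕ} {L : BDeRhamPlus (integerC F) p} {r : ℕ} (h : IsBdRLimModFil F p x k L r) :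
    L - bmaxPlusToBdR F p x ∈ Ideal.span {(xiBdR : BDeRhamPlus (integerC F) p) ^ k} := by
  obtain ⟨r', h'⟩ := isBdRLimModFil_bmaxPlusToBdR x k
  exact h.sub_mem h'

/-! ## §3 Values: `B⁰_max`, `𝔸_inf`, `t`, `θ`, `Γ_F` -/

/-- **On `B⁰_max` the comparison is `ι₀ : B⁰_max ⊂ 𝔸_inf[1/p] → B_dR⁺`.** [cite: Colmez1998Annals, §III.2] -/
theorem bmaxPlusToBdR_of (y₀ : bmaxZero F p) :
    bmaxPlusToBdR F p (AdicCompletion.of (Ideal.span {(p : bmaxZero F p)}) (bmaxZero F p) y₀) =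
      algebraMap (Localization.Away (p : Ainf (p := p) F)) (BDeRhamPlus (integerC F) p) (y₀ : Localization.Away (p : Ainf (p := p) F)) :=
  bmaxPlusToBdR_eq_of_forall fun k => ⟨0, bdR_lim_modFil_of y₀ k⟩

/-- **On `𝔸_inf` the comparison is `ι : 𝔸_inf → B_dR⁺`.** [cite: Colmez1998Annals, §III.2] -/
theorem bmaxPlusToBdR_ainfToBmaxPlus (a : Ainf (p := p) F) : bmaxPlusToBdR F p (ainfToBmaxPlus F p a) = ainfToBdR a :=
  bmaxPlusToBdR_eq_of_forall fun k => ⟨0, bdR_lim_modFil_ainfToBmaxPlus a k⟩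

/-- `ℤ_p`-scalars: `ι(zpToAinf c) ↦ qpToBdR c`. [cite: Colmez1998Annals, §III.2] -/
theorem bmaxPlusToBdR_ainfToBmaxPlus_zpToAinf (c : ℤ_[p]) :
    bmaxPlusToBdR F p (ainfToBmaxPlus F p (zpToAinf c)) = qpToBdR (c : ℚ_[p]) := by
  rw [bmaxPlusToBdR_ainfToBmaxPlus, qpToBdR_coe]

/-- ★ **`t ↦ t`**: the comparison sends `t_max = log[ε] ∈ B_max⁺` (`p`-adic limit) to `t_dR ∈ B_dR⁺` (`ξ`-adic limit) (`bdR_lim_modFil_tBmax`).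
[cite: Colmez1998Annals, §III.2] [cite: FontaineAsterisque223III, Exp. II §1.5.4] -/
theorem bmaxPlusToBdR_tBmax : bmaxPlusToBdR F p (tBmax (F := F) (p := p)) = tBdR :=
  bmaxPlusToBdR_eq_of_forall fun k => ⟨k, bdR_lim_modFil_tBmax k⟩

/-- ★ **`θ_dR ∘ (B_max⁺ → B_dR⁺) = θ_max`** (`thetaBdR_eq_of_bdR_lim_modFil` at level `1`). [cite: Colmez1998Annals, §III.2] -/
theorem thetaBdR_bmaxPlusToBdR (x : BmaxPlus F p) :
    thetaBdR (bmaxPlusToBdR F p x) = ((thetaBmaxPlus F p x : integerC F) : CompletedAlgClosure F) := by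
  obtain ⟨r, h⟩ := isBdRLimModFil_bmaxPlusToBdR x 1
  exact thetaBdR_eq_of_bdR_lim_modFil le_rfl h

/-- ★ **`Γ_F`-equivariance: `σ(bmaxPlusToBdR x) = bmaxPlusToBdR (σ x)`** (`bdR_lim_modFil_galBmaxPlus`). [cite: Colmez1998Annals, §III.2]
[cite: BergerLaurent2002, §1.2] -/
theorem galBdRPlus_bmaxPlusToBdR (σ : absoluteGaloisGroup F) (x : BmaxPlus F p) :
    galBdRPlus σ (bmaxPlusToBdR F p x) = bmaxPlusToBdR F p (galBmaxPlus σ x) :=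
  (bmaxPlusToBdR_eq_of_forall fun k => by
    obtain ⟨r, h⟩ := isBdRLimModFil_bmaxPlusToBdR x k
    exact ⟨r, bdR_lim_modFil_galBmaxPlus σ h⟩).symm

end Literature.NumberTheory.PAdicHodge

end
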